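import Literature.AlgebraicGeometry.ComplexMultiplication.CMAbelianVarietySimpleIffEndRank
import Literature.FieldTheory.AlgClosed.AutFixedSubfield
import HarnessLib

/-!
# Compatible pairs of embeddings for a PRIMITIVE CM type: `Hom ≠ 0` out of a simple CM abelian variety forces
# the target type to be induced, and `rk_ℤ Hom(A₀, A₁) ∈ {0, 2 dim A₀}` for simple CM abelian varieties
# (Milne CM Prop. 3.13 / Shimura 1998 §8.2 Prop. 26, on `Hom` spaces)

Topic `Literature/AlgebraicGeometry/ComplexMultiplication` (family `hodge`, lane `lit-hodgefound`, Layer A3).  Sequel of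
`CMAbelianVarietyHomRanksOfTwoTypes` (`rk_ℤ Hom(A₀, A₁) = #C(Φ₀, Φ₁)`, `Hom(A₀, A₁) = 0 ⟺ C(Φ₀, Φ₁) = ∅`), of
`CMAbelianVarietySimpleIffEndRank` and `SimpleIffPrimitiveCMType` (`A` simple ⟺ compatible embeddings of its type
coincide — Shimura §8.2 Prop. 26 in `Aut(ℂ)`-form), of `Motives/HodgeStructureOfCMTypeHomSpaces`
(`exists_hom_ofCMType_ne_zero_iff`: `Hom_{ℚ-HS}(V¹_{Φ₁}, V¹_{Φ₀}) ≠ 0 ⟺ C(Φ₀, Φ₁) ≠ ∅`) and of the `Aut(ℂ)` Galois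
theory of `FieldTheory/AlgClosed/AutFixedSubfield` (`ℂ^{Aut(ℂ/F)} = F` for countable `F`) and
`Motives/ZarhinHodgeGroupAutC` (`Aut(ℂ)` is transitive on `Hom(K, ℂ)`).

Here `C(Φ₀, Φ₁) = {(s,t) ∈ Hom(K₀,ℂ) × Hom(K₁,ℂ) | ∀ τ ∈ Aut(ℂ), τ ∘ s ∈ Φ₀ ⟺ τ ∘ t ∈ Φ₁}` (written out, as in the
files above), and «`Φ₀` primitive» is the `Aut(ℂ)`-form `∀ s s', (s, s') ∈ C(Φ₀, Φ₀) → s = s'` of those files.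

SOURCES.  J. S. Milne, *Complex Multiplication* [MilneCM2006] Ch. I §3 Prop. 3.13 p. 30 («Let `A` be a simple
abelian variety with complex multiplication, and let `E = End⁰(A)`. Then `(E; Φ_A)` is a primitive CM-type, and the map
`A ↦ (E; Φ_A)` defines a bijection from the set of isogeny classes of simple abelian varieties with complex
multiplication to the set of isomorphism classes of primitive CM-pairs»; proof: «If `(E; Φ_A)` is not primitive, and so
is the extension of a CM-type `(E₀; Φ₀)` with `E₀` a proper subfield of `E`, then `A` will be isogenous to
`A_{Φ₀}^{[E:E₀]}`, and so is not simple»), Prop. 3.12, §5 Prop. 5.2; G. Shimura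
[Shimura1998] §8.2 PROP. 26 p. 63 («`(F; {φᵢ})` is primitive if and only if `H₁ = H'`», with
`H' = {γ | γS = S}`), §6.2 THM. 3 pp. 41–43 (an abelian variety of an induced type `(F; Φ₀^F)` is isogenous to a power of
one of the primitive type), §5.1 PROP. 3 p. 36; P. Deligne, J. S. Milne [DeligneMilne1982Tannakian] II §6 Thm. 6.20
(Riemann: `Hom(A₀, A₁) ⊗ ℚ = Hom_{Hod_ℚ}(H¹_B(A₁), H¹_B(A₀))`).  The statements below are the `Hom`-space form of these
(non-zero homomorphisms instead of isogenies, ranks instead of isogeny classes), DERIVED from the tree's theorems;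
the isogeny form for CM fields is the tree's `isIsogenous_iff_exists_ringEquiv` (`SimpleCMAbelianVarietyIsogenyClasses`).

WHAT IS PROVED (theorems only; NO definition, NO named fact — D-0026 net debt 0; ANY number fields, unconditional):
* §1 (namespace `Literature.AlgebraicGeometry.Motives.CMType`; CM types `Φ₀` of `K₀`, `Φ₁` of `K₁`, `Φ₀` PRIMITIVE)
  `forall_comp_mem_iff_comp_ringEquiv` (`C` is `Aut(ℂ)`-stable diagonally) · `comp_eq_self_of_forall_comp_mem_iff`
  (for `(s,t) ∈ C`: an automorphism fixing `t` fixes `s`) · **`fieldRange_le_of_forall_comp_mem_iff`** (`s(K₀) ⊆ t(K₁)`,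
  by `ℂ^{Aut(ℂ/t(K₁))} = t(K₁)`) · **`exists_ringHom_comp_eq_of_forall_comp_mem_iff`** (there is `k : K₀ → K₁` with
  `t ∘ k = s` and `Φ₁ = {u | u ∘ k ∈ Φ₀}` — the target type is INDUCED from `Φ₀`; Milne's «`(E'; Φ')` is an extension
  of `(E; Φ)`») · `finrank_le_of_forall_comp_mem_iff` (`[K₀:ℚ] ≤ [K₁:ℚ]`) · for BOTH types primitive
  **`exists_ringEquiv_comp_eq_of_forall_comp_mem_iff`** (an isomorphism of CM pairs `e : (K₀; Φ₀) ≅ (K₁; Φ₁)` with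
  `t ∘ e = s`) · `setOf_forall_comp_mem_iff_eq_range_of_ringEquiv` / **`ncard_setOf_forall_comp_mem_iff_of_ringEquiv`**
  (for isomorphic pairs with `Φ₀` primitive, `C(Φ₀, Φ₁) = {(σ, σ ∘ e⁻¹)}` has exactly `[K₀:ℚ]` elements) ·
  `exists_forall_comp_mem_iff_iff_exists_ringEquiv` (`C ≠ ∅ ⟺ (K₀; Φ₀) ≅ (K₁; Φ₁)`, both primitive).
* §2 (namespace `Literature.AlgebraicGeometry.Motives.HodgeStructure`, the weight-one Hodge structures `V¹_{(K,Φ)}`)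
  `exists_ringHom_of_exists_hom_ofCMType_ne_zero` (`Φ₀` primitive, `Hom_{ℚ-HS}(V¹_{Φ₁}, V¹_{Φ₀}) ≠ 0` ⟹ `Φ₁` induced
  from `Φ₀`) · **`exists_hom_ofCMType_ne_zero_iff_exists_ringEquiv`** (both primitive: `Hom ≠ 0 ⟺` isomorphic pairs) ·
  `finrank_hom_ofCMType_eq_finrank_of_ringEquiv` (`= [K₀:ℚ]` for isomorphic pairs) ·
  `finrank_hom_ofCMType_eq_zero_or_eq_finrank` (both primitive: `dim Hom ∈ {0, [K₀:ℚ]}`).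
* §3 (namespace `Literature.AlgebraicGeometry.ComplexMultiplication`, realisations `A₀` of `(K₀; Φ₀)`, `A₁` of
  `(K₁; Φ₁)`, `IsCMTypeRealisation`) **`IsCMTypeRealisation.exists_ringHom_of_exists_hom_ne_zero`** (`A₀` SIMPLE and
  `Hom(A₀, A₁) ≠ 0` ⟹ `Φ₁` is induced from `Φ₀` along some `k : K₀ → K₁`; so `dim A₀ ≤ dim A₁`,
  `dim_le_dim_of_exists_hom_ne_zero`) · **`exists_hom_ne_zero_iff_exists_ringEquiv`** (`A₀, A₁` simple:
  `Hom(A₀, A₁) ≠ 0 ⟺ (K₀; Φ₀) ≅ (K₁; Φ₁)`) · `finrank_hom_eq_finrank_of_ringEquiv` (`rk_ℤ Hom(A₀, A₁) = [K₀:ℚ]` for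
  isomorphic pairs, `A₀` simple) · **`finrank_hom_eq_zero_or_eq_two_mul_dim`** (`A₀, A₁` simple CM:
  `rk_ℤ Hom(A₀, A₁) ∈ {0, 2 dim A₀}`).

## Provenance
Lane `lit-hodgefound`, prover seat `lit-hodgefound-p29` (generation 12), self-proposed row g12-#4.

## References
* [MilneCM2006] J. S. Milne, *Complex Multiplication* (2006) — Ch. I §3 Prop. 3.13 (p. 30) with proof, §5 Prop. 5.2.
* [Shimura1998] G. Shimura, *Abelian Varieties with Complex Multiplication and Modular Functions* (1998) — §5.1 Prop. 3
  (p. 36), §6.2 Thm. 3 (pp. 41–43), §8.2 Prop. 26 (p. 63).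
* [DeligneMilne1982Tannakian] P. Deligne, J. S. Milne, *Tannakian Categories*, LNM 900 (1982) — II §6 Thm. 6.20.
* [Lang2002] S. Lang, *Algebra* (2002) — Ch. VIII §1 (automorphisms of `ℂ`).
-/

noncomputable section

open scoped Cardinal
open NumberField CategoryTheory Module

/-! ## §1 Compatible pairs for a primitive type: field inclusion, induced type, isomorphism of CM pairs, the count -/

namespace Literature.AlgebraicGeometry.Motives.CMType

variable {K₀ K₁ : Type} [Field K₀] [NumberField K₀] [Field K₁] [NumberField K₁] {Φ₀ : CMType K₀} {Φ₁ : CMType K₁}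
  {s : K₀ →+* ℂ} {t : K₁ →+* ℂ}

omit [NumberField K₀] [NumberField K₁] in
/-- `C(Φ₀, Φ₁)` is stable under the diagonal action of `Aut(ℂ)`: if `(s, t)` is compatible then so is
`(γ ∘ s, γ ∘ t)`. [cite: Shimura1998, §8.2 (action of `G` on the embeddings)] -/
theorem forall_comp_mem_iff_comp_ringEquiv
    (h : ∀ τ : ℂ ≃+* ℂ, (τ : ℂ →+* ℂ).comp s ∈ Φ₀.1 ↔ (τ : ℂ →+* ℂ).comp t ∈ Φ₁.1) (γ : ℂ ≃+* ℂ) (τ : ℂ ≃+* ℂ) :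
    (τ : ℂ →+* ℂ).comp ((γ : ℂ →+* ℂ).comp s) ∈ Φ₀.1 ↔ (τ : ℂ →+* ℂ).comp ((γ : ℂ →+* ℂ).comp t) ∈ Φ₁.1 := by
  rw [← RingHom.comp_assoc, ← RingHom.comp_assoc, ← RingEquiv.coe_ringHom_trans]
  exact h (γ.trans τ)

omit [NumberField K₀] [NumberField K₁] in
/-- **For `Φ₀` primitive and `(s, t) ∈ C(Φ₀, Φ₁)`, every automorphism of `ℂ` fixing `t` fixes `s`**: `(s, γ ∘ s)` is
then a compatible pair of `(Φ₀, Φ₀)`, so `γ ∘ s = s` («`H' = H₁`»). [cite: Shimura1998, §8.2 Prop. 26 (p. 63)] -/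
theorem comp_eq_self_of_forall_comp_mem_iff
    (hprim : ∀ s s' : K₀ →+* ℂ,
      (∀ τ : ℂ ≃+* ℂ, (τ : ℂ →+* ℂ).comp s ∈ Φ₀.1 ↔ (τ : ℂ →+* ℂ).comp s' ∈ Φ₀.1) → s = s')
    (h : ∀ τ : ℂ ≃+* ℂ, (τ : ℂ →+* ℂ).comp s ∈ Φ₀.1 ↔ (τ : ℂ →+* ℂ).comp t ∈ Φ₁.1) {γ : ℂ ≃+* ℂ}
    (hγ : (γ : ℂ →+* ℂ).comp t = t) : (γ : ℂ →+* ℂ).comp s = s := by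
  refine (hprim s _ fun τ => ?_).symm
  rw [h τ, ← RingHom.comp_assoc, ← RingEquiv.coe_ringHom_trans, h (γ.trans τ), RingEquiv.coe_ringHom_trans,
    RingHom.comp_assoc, hγ]

omit [NumberField K₀] in
/-- **`s(K₀) ⊆ t(K₁)` for `Φ₀` primitive and `(s, t) ∈ C(Φ₀, Φ₁)`**: every automorphism of `ℂ` over the countable
subfield `t(K₁)` fixes `s(K₀)` pointwise (`comp_eq_self_of_forall_comp_mem_iff`), and `ℂ^{Aut(ℂ/t(K₁))} = t(K₁)`
(the tree's `Complex.mem_subfield_of_forall_ringEquiv`). [cite: Shimura1998, §8.2 Prop. 26 (proof: «F contains the field K' corresponding to H'»)]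
[cite: Lang2002, Ch. VIII §1] -/
theorem fieldRange_le_of_forall_comp_mem_iff
    (hprim : ∀ s s' : K₀ →+* ℂ,
      (∀ τ : ℂ ≃+* ℂ, (τ : ℂ →+* ℂ).comp s ∈ Φ₀.1 ↔ (τ : ℂ →+* ℂ).comp s' ∈ Φ₀.1) → s = s')
    (h : ∀ τ : ℂ ≃+* ℂ, (τ : ℂ →+* ℂ).comp s ∈ Φ₀.1 ↔ (τ : ℂ →+* ℂ).comp t ∈ Φ₁.1) :
    s.fieldRange ≤ t.fieldRange := by
  haveI : Countable K₁ := Countable.of_equiv _ (Module.finBasis ℚ K₁).equivFun.toEquiv.symm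
  haveI : Countable t.fieldRange := Countable.of_equiv _ t.rangeRestrictFieldEquiv.toEquiv
  have hcount : #t.fieldRange ≤ ℵ₀ := Cardinal.mk_le_aleph0
  intro x hx
  obtain ⟨k, rfl⟩ := RingHom.mem_fieldRange.1 hx
  refine FieldTheory.AlgClosed.Complex.mem_subfield_of_forall_ringEquiv t.fieldRange hcount fun σ hσ => ?_
  have hσt : (σ : ℂ →+* ℂ).comp t = t := RingHom.ext fun y => hσ (t y) (t.mem_fieldRange_self y)
  exact RingHom.congr_fun (comp_eq_self_of_forall_comp_mem_iff hprim h hσt) k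

omit [NumberField K₀] in
/-- **The target type is induced** (the type `Φ₁` «is the extension of» `Φ₀`, in the words of Milne Prop. 3.13): for
`Φ₀` primitive and `(s, t) ∈ C(Φ₀, Φ₁)` there is a field embedding `k : K₀ → K₁` with `t ∘ k = s` and
`Φ₁ = {u : K₁ → ℂ | u ∘ k ∈ Φ₀}` (every `u` is `τ ∘ t`, `τ ∈ Aut(ℂ)` — transitivity, the tree's
`ZarhinLie.exists_ringEquiv_complex_comp_eq`). [cite: MilneCM2006, Ch. I §3 Prop. 3.13 (p. 30) with proof]
[cite: Shimura1998, §8.2 Prop. 26 and §6.2 Thm. 3] -/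
theorem exists_ringHom_comp_eq_of_forall_comp_mem_iff
    (hprim : ∀ s s' : K₀ →+* ℂ,
      (∀ τ : ℂ ≃+* ℂ, (τ : ℂ →+* ℂ).comp s ∈ Φ₀.1 ↔ (τ : ℂ →+* ℂ).comp s' ∈ Φ₀.1) → s = s')
    (h : ∀ τ : ℂ ≃+* ℂ, (τ : ℂ →+* ℂ).comp s ∈ Φ₀.1 ↔ (τ : ℂ →+* ℂ).comp t ∈ Φ₁.1) :
    ∃ k : K₀ →+* K₁, t.comp k = s ∧ ∀ u : K₁ →+* ℂ, u ∈ Φ₁.1 ↔ u.comp k ∈ Φ₀.1 := by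
  have hle := fieldRange_le_of_forall_comp_mem_iff hprim h
  let k : K₀ →+* K₁ :=
    t.rangeRestrictFieldEquiv.symm.toRingHom.comp ((Subfield.inclusion hle).comp s.rangeRestrictField)
  have hk : t.comp k = s := by
    ext a
    change t (t.rangeRestrictFieldEquiv.symm (Subfield.inclusion hle (s.rangeRestrictField a))) = s a
    rw [RingHom.rangeRestrictFieldEquiv_apply_symm_apply]
    rfl
  refine ⟨k, hk, fun u => ?_⟩
  haveI : Countable K₁ := Countable.of_equiv _ (Module.finBasis ℚ K₁).equivFun.toEquiv.symm
  obtain ⟨τ, hτ⟩ := ZarhinLie.exists_ringEquiv_complex_comp_eq t u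
  have hu : u = (τ : ℂ →+* ℂ).comp t := RingHom.ext fun a => (hτ a).symm
  rw [hu, RingHom.comp_assoc, hk]
  exact (h τ).symm

/-- **`[K₀:ℚ] ≤ [K₁:ℚ]`** when `Φ₀` is primitive and `C(Φ₀, Φ₁) ∋ (s, t)` (`K₀ ↪ K₁`).
[cite: MilneCM2006, Ch. I §3 Prop. 3.13 (p. 30) with proof] -/
theorem finrank_le_of_forall_comp_mem_iff
    (hprim : ∀ s s' : K₀ →+* ℂ,
      (∀ τ : ℂ ≃+* ℂ, (τ : ℂ →+* ℂ).comp s ∈ Φ₀.1 ↔ (τ : ℂ →+* ℂ).comp s' ∈ Φ₀.1) → s = s')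
    (h : ∀ τ : ℂ ≃+* ℂ, (τ : ℂ →+* ℂ).comp s ∈ Φ₀.1 ↔ (τ : ℂ →+* ℂ).comp t ∈ Φ₁.1) :
    finrank ℚ K₀ ≤ finrank ℚ K₁ := by
  obtain ⟨k, -, -⟩ := exists_ringHom_comp_eq_of_forall_comp_mem_iff hprim h
  exact LinearMap.finrank_le_finrank_of_injective (f := k.toRatAlgHom.toLinearMap) k.injective

/-- **An isomorphism of CM pairs from a compatible pair between PRIMITIVE types** (Milne Prop. 3.13: isogeny classes
of simple CM abelian varieties ↔ isomorphism classes of primitive CM pairs — the combinatorial core): if `Φ₀` and `Φ₁`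
are primitive and `(s, t) ∈ C(Φ₀, Φ₁)`, there is `e : K₀ ≃ K₁` with `t ∘ e = s` and `Φ₁ = {u | u ∘ e ∈ Φ₀}`.
[cite: MilneCM2006, Ch. I §3 Prop. 3.13 (p. 30)] [cite: Shimura1998, §8.2 Prop. 26] -/
theorem exists_ringEquiv_comp_eq_of_forall_comp_mem_iff
    (hprim₀ : ∀ s s' : K₀ →+* ℂ,
      (∀ τ : ℂ ≃+* ℂ, (τ : ℂ →+* ℂ).comp s ∈ Φ₀.1 ↔ (τ : ℂ →+* ℂ).comp s' ∈ Φ₀.1) → s = s')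
    (hprim₁ : ∀ t t' : K₁ →+* ℂ,
      (∀ τ : ℂ ≃+* ℂ, (τ : ℂ →+* ℂ).comp t ∈ Φ₁.1 ↔ (τ : ℂ →+* ℂ).comp t' ∈ Φ₁.1) → t = t')
    (h : ∀ τ : ℂ ≃+* ℂ, (τ : ℂ →+* ℂ).comp s ∈ Φ₀.1 ↔ (τ : ℂ →+* ℂ).comp t ∈ Φ₁.1) :
    ∃ e : K₀ ≃+* K₁, t.comp e.toRingHom = s ∧ ∀ u : K₁ →+* ℂ, u ∈ Φ₁.1 ↔ u.comp e.toRingHom ∈ Φ₀.1 := by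
  obtain ⟨k, hk, hΦ⟩ := exists_ringHom_comp_eq_of_forall_comp_mem_iff hprim₀ h
  obtain ⟨k', hk', -⟩ := exists_ringHom_comp_eq_of_forall_comp_mem_iff (Φ₀ := Φ₁) (Φ₁ := Φ₀) hprim₁
    fun τ => (h τ).symm
  have hkk' : ∀ b, k (k' b) = b := fun b =>
    t.injective (by rw [← RingHom.comp_apply, ← RingHom.comp_apply, hk, hk'])
  have hbij : Function.Bijective k := ⟨k.injective, fun b => ⟨k' b, hkk' b⟩⟩
  exact ⟨RingEquiv.ofBijective k hbij, hk, hΦ⟩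

omit [NumberField K₀] [NumberField K₁] in
/-- **For ISOMORPHIC pairs with `Φ₀` primitive, `C(Φ₀, Φ₁)` is the graph `{(σ, σ ∘ e⁻¹) | σ ∈ Hom(K₀, ℂ)}`**
(`(σ, u)` compatible ⟹ `(σ, u ∘ e)` compatible in `(Φ₀, Φ₀)` ⟹ `σ = u ∘ e`).
[cite: Shimura1998, §8.2 Prop. 26] [cite: MilneCM2006, Ch. I §5 Prop. 5.2] -/
theorem setOf_forall_comp_mem_iff_eq_range_of_ringEquiv
    (hprim₀ : ∀ s s' : K₀ →+* ℂ,
      (∀ τ : ℂ ≃+* ℂ, (τ : ℂ →+* ℂ).comp s ∈ Φ₀.1 ↔ (τ : ℂ →+* ℂ).comp s' ∈ Φ₀.1) → s = s')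
    (e : K₀ ≃+* K₁) (he : ∀ u : K₁ →+* ℂ, u ∈ Φ₁.1 ↔ u.comp e.toRingHom ∈ Φ₀.1) :
    {q : (K₀ →+* ℂ) × (K₁ →+* ℂ) | ∀ τ : ℂ ≃+* ℂ,
        ((τ : ℂ →+* ℂ).comp q.1 ∈ Φ₀.1 ↔ (τ : ℂ →+* ℂ).comp q.2 ∈ Φ₁.1)} =
      Set.range fun σ : K₀ →+* ℂ => (σ, σ.comp e.symm.toRingHom) := by
  ext ⟨σ, u⟩
  simp only [Set.mem_setOf_eq, Set.mem_range, Prod.mk.injEq]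
  constructor
  · intro hq
    have hσ : σ = u.comp e.toRingHom := hprim₀ σ _ fun τ => by rw [hq τ, he, RingHom.comp_assoc]
    refine ⟨σ, rfl, ?_⟩
    rw [hσ, RingHom.comp_assoc, RingEquiv.toRingHom_comp_symm_toRingHom, RingHom.comp_id]
  · rintro ⟨σ', rfl, rfl⟩ τ
    rw [he, RingHom.comp_assoc, RingHom.comp_assoc, RingEquiv.symm_toRingHom_comp_toRingHom, RingHom.comp_id]

omit [NumberField K₁] in
/-- **`#C(Φ₀, Φ₁) = [K₀:ℚ]` for isomorphic CM pairs with `Φ₀` primitive.** [cite: MilneCM2006, Ch. I §5 Prop. 5.2]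
[cite: Shimura1998, §8.2 Prop. 26] -/
theorem ncard_setOf_forall_comp_mem_iff_of_ringEquiv
    (hprim₀ : ∀ s s' : K₀ →+* ℂ,
      (∀ τ : ℂ ≃+* ℂ, (τ : ℂ →+* ℂ).comp s ∈ Φ₀.1 ↔ (τ : ℂ →+* ℂ).comp s' ∈ Φ₀.1) → s = s')
    (e : K₀ ≃+* K₁) (he : ∀ u : K₁ →+* ℂ, u ∈ Φ₁.1 ↔ u.comp e.toRingHom ∈ Φ₀.1) :
    {q : (K₀ →+* ℂ) × (K₁ →+* ℂ) | ∀ τ : ℂ ≃+* ℂ,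
        ((τ : ℂ →+* ℂ).comp q.1 ∈ Φ₀.1 ↔ (τ : ℂ →+* ℂ).comp q.2 ∈ Φ₁.1)}.ncard = finrank ℚ K₀ := by
  classical
  rw [setOf_forall_comp_mem_iff_eq_range_of_ringEquiv hprim₀ e he,
    Set.ncard_range_of_injective fun a b hab => (Prod.ext_iff.1 hab).1, Nat.card_eq_fintype_card, Embeddings.card]

omit [NumberField K₀] [NumberField K₁] in
/-- A transported type always has compatible pairs: `(σ, σ ∘ e⁻¹) ∈ C(Φ₀, Φ₁)` (no primitivity needed).
[cite: MilneCM2006, Ch. I §3 Prop. 3.12] -/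
theorem forall_comp_mem_iff_comp_symm (e : K₀ ≃+* K₁) (he : ∀ u : K₁ →+* ℂ, u ∈ Φ₁.1 ↔ u.comp e.toRingHom ∈ Φ₀.1)
    (σ : K₀ →+* ℂ) (τ : ℂ ≃+* ℂ) :
    (τ : ℂ →+* ℂ).comp σ ∈ Φ₀.1 ↔ (τ : ℂ →+* ℂ).comp (σ.comp e.symm.toRingHom) ∈ Φ₁.1 := by
  rw [he, RingHom.comp_assoc, RingHom.comp_assoc, RingEquiv.symm_toRingHom_comp_toRingHom, RingHom.comp_id]

/-- **`C(Φ₀, Φ₁) ≠ ∅ ⟺ (K₀; Φ₀) ≅ (K₁; Φ₁)`** for two PRIMITIVE types. [cite: MilneCM2006, Ch. I §3 Prop. 3.13 (p. 30)] -/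
theorem exists_forall_comp_mem_iff_iff_exists_ringEquiv
    (hprim₀ : ∀ s s' : K₀ →+* ℂ,
      (∀ τ : ℂ ≃+* ℂ, (τ : ℂ →+* ℂ).comp s ∈ Φ₀.1 ↔ (τ : ℂ →+* ℂ).comp s' ∈ Φ₀.1) → s = s')
    (hprim₁ : ∀ t t' : K₁ →+* ℂ,
      (∀ τ : ℂ ≃+* ℂ, (τ : ℂ →+* ℂ).comp t ∈ Φ₁.1 ↔ (τ : ℂ →+* ℂ).comp t' ∈ Φ₁.1) → t = t') :
    (∃ (s : K₀ →+* ℂ) (t : K₁ →+* ℂ), ∀ τ : ℂ ≃+* ℂ,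
        (τ : ℂ →+* ℂ).comp s ∈ Φ₀.1 ↔ (τ : ℂ →+* ℂ).comp t ∈ Φ₁.1) ↔
      ∃ e : K₀ ≃+* K₁, ∀ u : K₁ →+* ℂ, u ∈ Φ₁.1 ↔ u.comp e.toRingHom ∈ Φ₀.1 := by
  constructor
  · rintro ⟨s, t, h⟩
    obtain ⟨e, -, he⟩ := exists_ringEquiv_comp_eq_of_forall_comp_mem_iff hprim₀ hprim₁ h
    exact ⟨e, he⟩
  · rintro ⟨e, he⟩
    have hpos : 0 < Fintype.card (K₀ →+* ℂ) := by rw [Embeddings.card]; exact finrank_pos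
    obtain ⟨σ⟩ := Fintype.card_pos_iff.1 hpos
    exact ⟨σ, σ.comp e.symm.toRingHom, forall_comp_mem_iff_comp_symm e he σ⟩

end Literature.AlgebraicGeometry.Motives.CMType

/-! ## §2 The weight-one Hodge structures: `Hom_{ℚ-HS}(V¹_{Φ₁}, V¹_{Φ₀}) ≠ 0` for primitive types -/

namespace Literature.AlgebraicGeometry.Motives.HodgeStructure

variable {K₀ K₁ : Type} [Field K₀] [NumberField K₀] [Field K₁] [NumberField K₁] (Φ₀ : CMType K₀) (Φ₁ : CMType K₁)

/-- **A non-zero morphism of Hodge structures `V¹_{(K₁,Φ₁)} → V¹_{(K₀,Φ₀)}` with `Φ₀` primitive forces `Φ₁` to be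
induced from `Φ₀`** along a field embedding `k : K₀ → K₁` (`exists_hom_ofCMType_ne_zero_iff` and §1).
[cite: MilneCM2006, Ch. I §3 Prop. 3.13 (p. 30) and §5 Prop. 5.2] -/
theorem exists_ringHom_of_exists_hom_ofCMType_ne_zero
    (hprim₀ : ∀ s s' : K₀ →+* ℂ,
      (∀ τ : ℂ ≃+* ℂ, (τ : ℂ →+* ℂ).comp s ∈ Φ₀.1 ↔ (τ : ℂ →+* ℂ).comp s' ∈ Φ₀.1) → s = s')
    (hne : ∃ φ : Hom (ofCMType Φ₁) (ofCMType Φ₀), φ ≠ 0) :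
    ∃ k : K₀ →+* K₁, ∀ u : K₁ →+* ℂ, u ∈ Φ₁.1 ↔ u.comp k ∈ Φ₀.1 := by
  obtain ⟨s, t, h⟩ := (exists_hom_ofCMType_ne_zero_iff Φ₀ Φ₁).1 hne
  obtain ⟨k, -, hk⟩ := CMType.exists_ringHom_comp_eq_of_forall_comp_mem_iff hprim₀ h
  exact ⟨k, hk⟩

/-- **For PRIMITIVE `Φ₀, Φ₁`: `Hom_{ℚ-HS}(V¹_{(K₁,Φ₁)}, V¹_{(K₀,Φ₀)}) ≠ 0` iff the CM pairs are isomorphic.**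
[cite: MilneCM2006, Ch. I §3 Prop. 3.13 (p. 30) and §5 Prop. 5.2] -/
theorem exists_hom_ofCMType_ne_zero_iff_exists_ringEquiv
    (hprim₀ : ∀ s s' : K₀ →+* ℂ,
      (∀ τ : ℂ ≃+* ℂ, (τ : ℂ →+* ℂ).comp s ∈ Φ₀.1 ↔ (τ : ℂ →+* ℂ).comp s' ∈ Φ₀.1) → s = s')
    (hprim₁ : ∀ t t' : K₁ →+* ℂ,
      (∀ τ : ℂ ≃+* ℂ, (τ : ℂ →+* ℂ).comp t ∈ Φ₁.1 ↔ (τ : ℂ →+* ℂ).comp t' ∈ Φ₁.1) → t = t') :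
    (∃ φ : Hom (ofCMType Φ₁) (ofCMType Φ₀), φ ≠ 0) ↔
      ∃ e : K₀ ≃+* K₁, ∀ u : K₁ →+* ℂ, u ∈ Φ₁.1 ↔ u.comp e.toRingHom ∈ Φ₀.1 := by
  rw [exists_hom_ofCMType_ne_zero_iff, CMType.exists_forall_comp_mem_iff_iff_exists_ringEquiv hprim₀ hprim₁]

/-- **`dim_ℚ Hom_{ℚ-HS}(V¹_{(K₁,Φ₁)}, V¹_{(K₀,Φ₀)}) = [K₀:ℚ]` for isomorphic CM pairs with `Φ₀` primitive** (the two Hodge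
structures are then isomorphic and `End = K₀`). [cite: MilneCM2006, Ch. I §5 Prop. 5.2] [cite: Shimura1998, §8.2 Prop. 26] -/
theorem finrank_hom_ofCMType_eq_finrank_of_ringEquiv
    (hprim₀ : ∀ s s' : K₀ →+* ℂ,
      (∀ τ : ℂ ≃+* ℂ, (τ : ℂ →+* ℂ).comp s ∈ Φ₀.1 ↔ (τ : ℂ →+* ℂ).comp s' ∈ Φ₀.1) → s = s')
    (e : K₀ ≃+* K₁) (he : ∀ u : K₁ →+* ℂ, u ∈ Φ₁.1 ↔ u.comp e.toRingHom ∈ Φ₀.1) :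
    finrank ℚ (Hom (ofCMType Φ₁) (ofCMType Φ₀)) = finrank ℚ K₀ := by
  rw [finrank_hom_ofCMType_eq_ncard, CMType.ncard_setOf_forall_comp_mem_iff_of_ringEquiv hprim₀ e he]

/-- **For PRIMITIVE `Φ₀, Φ₁`: `dim_ℚ Hom_{ℚ-HS}(V¹_{(K₁,Φ₁)}, V¹_{(K₀,Φ₀)}) ∈ {0, [K₀:ℚ]}`.**
[cite: MilneCM2006, Ch. I §3 Prop. 3.13 and §5 Prop. 5.2] -/
theorem finrank_hom_ofCMType_eq_zero_or_eq_finrank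
    (hprim₀ : ∀ s s' : K₀ →+* ℂ,
      (∀ τ : ℂ ≃+* ℂ, (τ : ℂ →+* ℂ).comp s ∈ Φ₀.1 ↔ (τ : ℂ →+* ℂ).comp s' ∈ Φ₀.1) → s = s')
    (hprim₁ : ∀ t t' : K₁ →+* ℂ,
      (∀ τ : ℂ ≃+* ℂ, (τ : ℂ →+* ℂ).comp t ∈ Φ₁.1 ↔ (τ : ℂ →+* ℂ).comp t' ∈ Φ₁.1) → t = t') :
    finrank ℚ (Hom (ofCMType Φ₁) (ofCMType Φ₀)) = 0 ∨
      finrank ℚ (Hom (ofCMType Φ₁) (ofCMType Φ₀)) = finrank ℚ K₀ := by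
  by_cases hne : ∃ φ : Hom (ofCMType Φ₁) (ofCMType Φ₀), φ ≠ 0
  · obtain ⟨e, he⟩ := (exists_hom_ofCMType_ne_zero_iff_exists_ringEquiv Φ₀ Φ₁ hprim₀ hprim₁).1 hne
    exact Or.inr (finrank_hom_ofCMType_eq_finrank_of_ringEquiv Φ₀ Φ₁ hprim₀ e he)
  · haveI := finite_hom_ofCMType Φ₀ Φ₁
    simp only [not_exists, not_not] at hne
    exact Or.inl ((finrank_zero_iff_forall_zero (K := ℚ)).2 hne)

end Literature.AlgebraicGeometry.Motives.HodgeStructure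

/-! ## §3 Simple CM abelian varieties: `Hom(A₀, A₁) ≠ 0` forces an induced / isomorphic type; `rk Hom ∈ {0, 2 dim A₀}` -/

namespace Literature.AlgebraicGeometry.ComplexMultiplication

open Literature.AlgebraicGeometry.Motives (CMType AbelianVariety)
open Literature.AlgebraicGeometry.HodgeTheory (complexBetti)

variable {K₀ K₁ : Type} [Field K₀] [NumberField K₀] [Field K₁] [NumberField K₁] {Φ₀ : CMType K₀} {Φ₁ : CMType K₁}
  {A₀ A₁ : AbelianVariety ℂ} {ι₀ : 𝓞 K₀ →+* End A₀} {θ₀ : K₀ →+* Module.End ℂ (complexBetti A₀.X 1)}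
  {ι₁ : 𝓞 K₁ →+* End A₁} {θ₁ : K₁ →+* Module.End ℂ (complexBetti A₁.X 1)}

/-- `Hom(A₀, A₁) ≠ 0` iff some pair of embeddings is compatible (the tree's `forall_hom_eq_zero_iff`, negated).
[cite: DeligneMilne1982Tannakian, II §6 Thm. 6.20 (Riemann)] [cite: MilneCM2006, Ch. I §5 Prop. 5.2] -/
theorem IsCMTypeRealisation.exists_hom_ne_zero_iff (h₀ : IsCMTypeRealisation Φ₀ A₀ ι₀ θ₀)
    (h₁ : IsCMTypeRealisation Φ₁ A₁ ι₁ θ₁) :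
    (∃ u : A₀ ⟶ A₁, u ≠ 0) ↔
      ∃ (s : K₀ →+* ℂ) (t : K₁ →+* ℂ), ∀ τ : ℂ ≃+* ℂ,
        (τ : ℂ →+* ℂ).comp s ∈ Φ₀.1 ↔ (τ : ℂ →+* ℂ).comp t ∈ Φ₁.1 := by
  have h := h₀.forall_hom_eq_zero_iff h₁
  constructor
  · rintro ⟨u, hu⟩
    by_contra hne
    simp only [not_exists, not_forall] at hne
    exact hu (h.2 hne u)
  · rintro ⟨s, t, hst⟩
    by_contra hne
    simp only [not_exists, not_not] at hne
    obtain ⟨τ, hτ⟩ := h.1 hne s t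
    exact hτ (hst τ)

/-- **A non-zero homomorphism out of a SIMPLE CM abelian variety forces the target type to be induced** (the
`Hom`-form of the injectivity in Milne Prop. 3.13 «the map `A ↦ (E; Φ_A)` defines a bijection from the set of isogeny
classes of simple abelian varieties with complex multiplication to the set of isomorphism classes of primitive
CM-pairs»): for realisations `A₀` of `(K₀; Φ₀)` (simple) and `A₁` of `(K₁; Φ₁)` with `Hom(A₀, A₁) ≠ 0` there is
`k : K₀ → K₁` with `Φ₁ = {u | u ∘ k ∈ Φ₀}`.
[cite: MilneCM2006, Ch. I §3 Prop. 3.13 (p. 30) with proof] [cite: Shimura1998, §8.2 Prop. 26 and §6.2 Thm. 3] -/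
theorem IsCMTypeRealisation.exists_ringHom_of_exists_hom_ne_zero (h₀ : IsCMTypeRealisation Φ₀ A₀ ι₀ θ₀)
    (h₁ : IsCMTypeRealisation Φ₁ A₁ ι₁ θ₁) (hs : A₀.IsSimple) (hne : ∃ u : A₀ ⟶ A₁, u ≠ 0) :
    ∃ k : K₀ →+* K₁, ∀ u : K₁ →+* ℂ, u ∈ Φ₁.1 ↔ u.comp k ∈ Φ₀.1 := by
  obtain ⟨s, t, hst⟩ := (h₀.exists_hom_ne_zero_iff h₁).1 hne
  obtain ⟨k, -, hk⟩ :=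
    Motives.CMType.exists_ringHom_comp_eq_of_forall_comp_mem_iff ((isSimple_iff_primitive h₀).1 hs) hst
  exact ⟨k, hk⟩

/-- **`dim A₀ ≤ dim A₁`** if `A₀` is a simple CM abelian variety with `Hom(A₀, A₁) ≠ 0`, `A₁` CM (`K₀ ↪ K₁` and
`[Kᵢ:ℚ] = 2 dim Aᵢ`). [cite: MilneCM2006, Ch. I §3 Prop. 3.13 (p. 30) with proof] [cite: Shimura1998, §5.1 Prop. 3] -/
theorem IsCMTypeRealisation.dim_le_dim_of_exists_hom_ne_zero (h₀ : IsCMTypeRealisation Φ₀ A₀ ι₀ θ₀)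
    (h₁ : IsCMTypeRealisation Φ₁ A₁ ι₁ θ₁) (hs : A₀.IsSimple) (hne : ∃ u : A₀ ⟶ A₁, u ≠ 0) : A₀.dim ≤ A₁.dim := by
  obtain ⟨s, t, hst⟩ := (h₀.exists_hom_ne_zero_iff h₁).1 hne
  have hle := Motives.CMType.finrank_le_of_forall_comp_mem_iff ((isSimple_iff_primitive h₀).1 hs) hst
  rw [← HodgeTheory.BettiUniverse.finrank_bettiCohomology_one_eq h₀.1 h₀.2.1,
    ← HodgeTheory.BettiUniverse.finrank_bettiCohomology_one_eq h₁.1 h₁.2.1,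
    HodgeTheory.finrank_bettiCohomology_one A₀, HodgeTheory.finrank_bettiCohomology_one A₁] at hle
  omega

/-- **Two SIMPLE CM abelian varieties have `Hom(A₀, A₁) ≠ 0` iff their CM pairs are isomorphic** (the `Hom` form of
Milne Prop. 3.13; no CM-field hypothesis). [cite: MilneCM2006, Ch. I §3 Prop. 3.13 (p. 30)]
[cite: DeligneMilne1982Tannakian, II §6 Thm. 6.20 (Riemann)] -/
theorem IsCMTypeRealisation.exists_hom_ne_zero_iff_exists_ringEquiv (h₀ : IsCMTypeRealisation Φ₀ A₀ ι₀ θ₀)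
    (h₁ : IsCMTypeRealisation Φ₁ A₁ ι₁ θ₁) (hs₀ : A₀.IsSimple) (hs₁ : A₁.IsSimple) :
    (∃ u : A₀ ⟶ A₁, u ≠ 0) ↔ ∃ e : K₀ ≃+* K₁, ∀ u : K₁ →+* ℂ, u ∈ Φ₁.1 ↔ u.comp e.toRingHom ∈ Φ₀.1 := by
  rw [h₀.exists_hom_ne_zero_iff h₁, Motives.CMType.exists_forall_comp_mem_iff_iff_exists_ringEquiv
    ((isSimple_iff_primitive h₀).1 hs₀) ((isSimple_iff_primitive h₁).1 hs₁)]

/-- **`rk_ℤ Hom(A₀, A₁) = [K₀:ℚ]` for realisations of ISOMORPHIC CM pairs with `A₀` simple** (`Hom⁰(A₀, A₁)` is a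
one-dimensional `K₀`-space, numerically). [cite: MilneCM2006, Ch. I §3 Prop. 3.13 and §5 Prop. 5.2]
[cite: Shimura1998, §6.1 Corollary of Theorem 2] -/
theorem IsCMTypeRealisation.finrank_hom_eq_finrank_of_ringEquiv (h₀ : IsCMTypeRealisation Φ₀ A₀ ι₀ θ₀)
    (h₁ : IsCMTypeRealisation Φ₁ A₁ ι₁ θ₁) (hs₀ : A₀.IsSimple) (e : K₀ ≃+* K₁)
    (he : ∀ u : K₁ →+* ℂ, u ∈ Φ₁.1 ↔ u.comp e.toRingHom ∈ Φ₀.1) :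
    Module.finrank ℤ (A₀ ⟶ A₁) = finrank ℚ K₀ := by
  rw [h₀.finrank_hom_eq_ncard h₁,
    Motives.CMType.ncard_setOf_forall_comp_mem_iff_of_ringEquiv ((isSimple_iff_primitive h₀).1 hs₀) e he]

/-- **`rk_ℤ Hom(A₀, A₁) ∈ {0, 2 dim A₀}` for two SIMPLE CM abelian varieties.**
[cite: MilneCM2006, Ch. I §3 Prop. 3.13 (p. 30) and §5 Prop. 5.2] [cite: Shimura1998, §5.1 Props. 3, 6] -/
theorem IsCMTypeRealisation.finrank_hom_eq_zero_or_eq_two_mul_dim (h₀ : IsCMTypeRealisation Φ₀ A₀ ι₀ θ₀)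
    (h₁ : IsCMTypeRealisation Φ₁ A₁ ι₁ θ₁) (hs₀ : A₀.IsSimple) (hs₁ : A₁.IsSimple) :
    Module.finrank ℤ (A₀ ⟶ A₁) = 0 ∨ Module.finrank ℤ (A₀ ⟶ A₁) = 2 * A₀.dim := by
  by_cases hne : ∃ u : A₀ ⟶ A₁, u ≠ 0
  · obtain ⟨e, he⟩ := (h₀.exists_hom_ne_zero_iff_exists_ringEquiv h₁ hs₀ hs₁).1 hne
    refine Or.inr ?_
    rw [h₀.finrank_hom_eq_finrank_of_ringEquiv h₁ hs₀ e he, ← HodgeTheory.finrank_bettiCohomology_one A₀,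
      HodgeTheory.BettiUniverse.finrank_bettiCohomology_one_eq h₀.1 h₀.2.1]
  · simp only [not_exists, not_not] at hne
    refine Or.inl ?_
    rw [h₀.finrank_hom_eq_ncard h₁, Set.ncard_eq_zero, Set.eq_empty_iff_forall_notMem]
    rintro ⟨s, t⟩ hst
    obtain ⟨τ, hτ⟩ := (h₀.forall_hom_eq_zero_iff h₁).1 hne s t
    exact hτ (hst τ)

end Literature.AlgebraicGeometry.ComplexMultiplication

end
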